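import Summits.BirchSwinnertonDyer.BirchSwinnertonDyer.Theses.InertBadSignedBranches
import Summits.BirchSwinnertonDyer.Rank1Residual.Additive.QuadraticBranchOddStrictExactControlDischarge
import HarnessLib

/-!
# Route `InertBadSignedBranches` (rung K8): the print-readings item `PrintReadingsInert` REDUCED to
# three print-shaped hypotheses (helper toward stmt-BirchSwinnertonDyer-19226; nothing asserted)

The route item (planner bsd-cm-plan g10; gate auto-crux, rank 9)
`Summit.BirchSwinnertonDyer.BirchSwinnertonDyer.Theses.InertBadSignedBranches.PrintReadingsInert`
is, for every prime `p ≥ 5`, the conjunction of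
* (C1_η) `Additive.QuadraticBranchPlusMainConjectureAt V p` for every CM curve `V/ℚ` (globally
  minimal) with good reduction at `p` and `p` inert in the CM field — Kobayashi's EVEN signed main
  conjecture on the quadratic branch `η = ω^{(p−1)/2}`; for CM curves this is the `ℚ(μ_{p^∞})`-variant
  of Pollack–Rubin's theorem, which the source states as a REMARK ("With the same proof (and a little
  extra notation) one can prove an analogous result for `Sel^±_p(E/Q(μ_{p^∞}))`", Ann. of Math. 159
  (2004) p. 448) — a conjecture-grade typed input of the tree, NOT a vendored theorem;
* for every `W` of signed local type `(p, I₀*)` and analytic rank one: (R2)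
  `Additive.OddBranchStrictMinusNoFiniteSubmoduleAt W p` (Kitajima–Otsuki 2018 Main Thm. 1.3, sign `−`,
  `η`-part, READ on the strict-minus dual datum) and the EXACT reading of Kobayashi 2003 Thm. 7.4 (ii)
  at `η` (`char X^{−,str}(W/ℚ_∞) = (L')` for `L_p⁻(V, η, X) = X·L'`, given (C1_η) at the twin).

THIS FILE proves ONE implication, sorry-free, with NO new definition and NO named fact minted:
`PrintReadingsInert` ⟸ `hC1` (the (C1_η) clause itself, as displayed) ∧ `hKO` ∧ `h74X`, where `hKO`
and `h74X` are the two readings in their VERBATIM, `W`-FREE SHAPES on the tree's `η`-part object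
`Additive.EtaSignedSelmerDualData V κ K₀ ℚ_[p] η γ (−1)` (cc-typer-6's texts `HKO p` / the exact frame
of `H74`), transported to every `W` on the type by the x1b dictionary theorems
`SignedTwist.oddBranchStrictMinusNoFiniteSubmoduleAt_of_kitajimaOtsuki13MinusEta` (P5-5b) and
`LevelBridge.exactOddBranchReading_of_kobayashi74OddEtaExact` (x1b GEN 44 file 123) — the same inputs
as the landed consumer `X12.O10.bsdp_of_hasSignedLocalType_IstarZero_of_valuation_of_verbatimReadings`
(p402929). HONEST STATUS: the item does NOT close by this file (conditional result): `hKO` / `h74X`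
are hypothesis TEXTS (the printed theorems live on a Summits-side object, so no Literature fact states
them today) and `hC1` has no named fact behind it (Pollack–Rubin's remark). What the file records for
the ledger is the exact residual debt of the item: two verbatim theorem shapes + (C1_η) for CM.
[cite: KitajimaOtsuki2018, Main Thm. 1.3 (= Thm. 4.8) with Def. 2.1 (arXiv:1607.03612 pp. 3, 6)]
[cite: Kobayashi2003, §4 (p. 8) and Thm. 7.4 (p. 13)]
[cite: PollackRubin2004, Theorem (p. 448) and the remark on Sel over ℚ(μ_{p^∞}) (p. 448)]
-/

set_option autoImplicit false
set_option linter.dupNamespace false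

noncomputable section

open scoped Classical MatrixGroups ModularForm

open CongruenceSubgroup Field WeierstrassCurve
open Literature.NumberTheory.EllipticCurves
open Literature.NumberTheory.EllipticCurves.ModularForms
open Literature.NumberTheory.EllipticCurves.Kobayashi2003 hiding EtaSignedSelmerDualData
  IsQuadraticBranchMinusLFunction
open Literature.NumberTheory.EllipticCurves.Rank1Residual
open Literature.NumberTheory.GaloisRepresentations
open Summit.BirchSwinnertonDyer.Rank1Residual.Additive

namespace Summit.BirchSwinnertonDyer.BirchSwinnertonDyer.Theorems

/-- **`PrintReadingsInert` from (C1_η)-for-CM and the two VERBATIM reading shapes.** Hypotheses: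
`hC1` = the (C1_η) clause of the item (Kobayashi's even main conjecture on the quadratic branch for CM
good-inert `V`, `p ≥ 5`; conjecture-grade typed input — Pollack–Rubin state the `ℚ(μ_{p^∞})` case as a
remark only); `hKO` = Kitajima–Otsuki 2018 Main Thm. 1.3 (sign `−`) on the `η`-part dual datum of ANY
good `a_p = 0` curve `V` over `ℚ(μ_p)` (text `HKO p`); `h74X` = Kobayashi 2003 Thm. 7.4 (ii) EXACT at
`η` on the same object. Conclusion: the route item, via the x1b dictionary theorems (P5-5b,
file 123). CONDITIONAL; nothing about the printed theorems is asserted; closes nothing by itself.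
[cite: KitajimaOtsuki2018, Main Thm. 1.3 (= Thm. 4.8) with Def. 2.1]
[cite: Kobayashi2003, Thm. 7.4 (p. 13), §4 (p. 8)] [cite: PollackRubin2004, p. 448 (remark)] -/
theorem inertBadSignedBranches_printReadingsInert_of_plusMC_of_verbatimReadings
    (hC1 : ∀ (p : ℕ) [Fact p.Prime], 5 ≤ p →
      ∀ (V : WeierstrassCurve ℚ) [V.IsElliptic] [V.IsGloballyMinimal], V.HasCM →
        V.HasGoodReductionAtPrime p → CMInert V p → QuadraticBranchPlusMainConjectureAt V p)
    (hKO : ∀ (p : ℕ) [Fact p.Prime], 5 ≤ p →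
      ∀ (K₀ : Type) [Field K₀] [NumberField K₀] [IsCyclotomicExtension {p} ℚ K₀]
        [(galRange (K := ℚ) K₀).Normal] (ηq : absoluteGaloisGroup ℚ →* ℤˣ),
        (∀ σ ∈ galRange (K := ℚ) K₀, ηq σ = 1) →
      ∀ (V : WeierstrassCurve ℚ) [V.IsElliptic] [V.IsGloballyMinimal],
        p ≠ 2 → V.HasGoodReductionAtPrime p → V.frobeniusTrace p = 0 →
      ∀ (κ : ZpExtension ℚ p) (γ : absoluteGaloisGroup ℚ),
        κ.IsCyclotomic → κ.IsTopGenerator γ → γ ∈ galRange (K := ℚ) K₀ →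
      ∀ (D : EtaSignedSelmerDualData V κ K₀ ℚ_[p] ηq γ (-1)),
        Module.Finite (IwasawaAlgebra p) D.X → Module.IsTorsion (IwasawaAlgebra p) D.X →
        ∀ M : Submodule (IwasawaAlgebra p) D.X, Finite M → M = ⊥)
    (h74X : ∀ (p : ℕ) [Fact p.Prime], 5 ≤ p →
      ∀ (K₀ : Type) [Field K₀] [NumberField K₀] [IsCyclotomicExtension {p} ℚ K₀]
        [(galRange (K := ℚ) K₀).Normal] (ηq : absoluteGaloisGroup ℚ →* ℤˣ),
        (∀ σ ∈ galRange (K := ℚ) K₀, ηq σ = 1) → ηq ≠ 1 →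
      ∀ (V : WeierstrassCurve ℚ) [V.IsElliptic] [V.IsGloballyMinimal] {N : ℕ} [NeZero N]
        {f : CuspForm (Gamma0 N) 2},
        p ≠ 2 → V.HasGoodReductionAtPrime p → V.frobeniusTrace p = 0 →
        QuadraticBranchPlusMainConjectureAt V p → IsNewformOf V f →
      ∀ (ϖ : ℚ), (if Even (p / 2) then (ϖ : ℝ) * V.realPeriodRat = plusPeriod f
          else (ϖ : ℝ) * V.imaginaryPeriodRat = minusPeriod f) →
      ∀ (Lη : IwasawaAlgebra p), IsQuadraticBranchMinusLFunction f p ϖ Lη →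
      ∀ (κ : ZpExtension ℚ p) (γ : absoluteGaloisGroup ℚ),
        κ.IsCyclotomic → κ.IsTopGenerator γ → γ ∈ galRange (K := ℚ) K₀ →
        IsCyclotomicVariable p γ →
      ∀ (D : EtaSignedSelmerDualData V κ K₀ ℚ_[p] ηq γ (-1)) (L' : IwasawaAlgebra p),
        Lη = PowerSeries.X * L' → D.charIdeal = Ideal.span {L'}) :
    Summit.BirchSwinnertonDyer.BirchSwinnertonDyer.Theses.InertBadSignedBranches.PrintReadingsInert := by
  unfold Summit.BirchSwinnertonDyer.BirchSwinnertonDyer.Theses.InertBadSignedBranches.PrintReadingsInert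
  intro p _ hp5
  refine ⟨fun V _ _ hCM hgood hin ↦ hC1 p hp5 V hCM hgood hin, fun W _ _ _hT _hr ↦ ⟨?_, ?_⟩⟩
  · exact SignedTwist.oddBranchStrictMinusNoFiniteSubmoduleAt_of_kitajimaOtsuki13MinusEta W p
      (hKO p hp5)
  · exact LevelBridge.exactOddBranchReading_of_kobayashi74OddEtaExact W p (h74X p hp5)

end Summit.BirchSwinnertonDyer.BirchSwinnertonDyer.Theorems

end
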